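import Literature.Analysis.SpecialFunctions.HypergeometricPolynomialOrthogonality
import Mathlib.Analysis.Calculus.ParametricIntervalIntegral
import Mathlib.Analysis.Calculus.Deriv.MeanValue
import Mathlib.Analysis.SpecialFunctions.Integrals.Basic
import HarnessLib

/-!
# Positivity and the sub-Markov property of the Jacobi heat flow on polynomials

Topic `Literature/Analysis/SpecialFunctions` (generic). Sequel of
`HypergeometricPolynomialOrthogonality.lean`; motivation: the order properties (`0 ≤ h ≤ 1`,
`h(θ, ·)` non-increasing, `h > 0`) of the explicit solution of LSW's boundary problem behind
`Literature.Probability.Percolation.LawlerSchrammWerner2002_hittingPDE` (LSW (2002), Lemma 2.2 and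
(2.2)). For `1 < c < 2`, `μ > 0` and finitely many coefficients `b_0, …, b_{N-1}`, the polynomial
heat flow

  `V(z, t) = Σ_{n<N} b_n e^{-μ n(n+1) t} y_n(z)`,  `∂ₜ V = μ [z(1-z) ∂²_z V + (c - 2z) ∂_z V]`,

is studied by two energy computations on `[0, 1]` (no boundary terms survive because the flux
coefficient `P = z^c (1-z)^{2-c}` vanishes at both ends):

* **positivity preservation** — if `V(·, 0) ≥ 0` on `[0, 1]` then `V(·, t) ≥ 0` for all `t ≥ 0`:
  `E(t) = ∫₀¹ ρ Φ(V)` with the convex `C²` function `Φ(x) = min(x, 0)⁴` has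
  `E' = -μ ∫₀¹ P Φ''(V) (∂_z V)² ≤ 0` and `E(0) = 0`;
* **the sub-Markov (flux) identity** — with `λ₀ = μ (c-1)(2-c)`,
  `d/dt [e^{-λ₀ t} ∫₀¹ (1-z)^{1-c} V(z, t) dz] = -μ (c-1) e^{-λ₀ t} V(0, t)`, whence the integral
  is non-increasing when `V ≥ 0` (the outgoing flux at the Dirichlet end `z = 0`; for LSW's
  parameters `μ = κ/8`, `c = 3/2 - 2/κ`, `λ₀ = (κ² - 16)/(32κ)` is the one-arm exponent and
  `(1-z)^{1-c} = ρ(z) z^{1-c}` is the weight times the lifted constant initial datum `1`).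

No named fact is introduced.

## Contents

* `negPartPow4`, `negPartPow3`, `negPartPow2` — `min(x,0)^k` and their derivatives;
* `jacobiHeatFin c μ b N` and its `z`-, `zz`-, `t`-derivatives, the heat equation
  `jacobiHeatFin_pde`, the self-adjoint form;
* `jacobiHeatFin_nonneg` — positivity preservation;
* `hasDerivAt_weightedIntegral_jacobiHeatFin`, `weightedIntegral_jacobiHeatFin_le` — the
  sub-Markov identity and inequality.

## References

* G. F. Lawler, O. Schramm, W. Werner, *One-arm exponent for critical 2D percolation*, Electron.
  J. Probab. 7 (2002), no. 2, Lemma 2.2, (2.2). [LawlerSchrammWernerEJP2002]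
* G. E. Andrews, R. Askey, R. Roy, *Special Functions*, CUP (1999), (2.3.5). [AndrewsAskeyRoy1999]
-/

noncomputable section

open Polynomial Set MeasureTheory intervalIntegral Filter
open scoped Topology Interval

namespace Literature.Analysis.SpecialFunctions

/-! ### The convex test function `Φ(x) = min(x, 0)⁴` -/

/-- `min(x, 0)^k` has derivative `k min(x,0)^{k-1}` for `k ≥ 2` (at `0` both sides vanish to
second order). [folklore] -/
theorem hasDerivAt_min_zero_pow (k : ℕ) (x : ℝ) :
    HasDerivAt (fun y : ℝ => min y 0 ^ (k + 2)) (((k : ℝ) + 2) * min x 0 ^ (k + 1)) x := by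
  rcases lt_trichotomy x 0 with hx | rfl | hx
  · have hev : (fun y : ℝ => min y 0 ^ (k + 2)) =ᶠ[𝓝 x] fun y => y ^ (k + 2) := by
      filter_upwards [gt_mem_nhds hx] with y hy
      rw [min_eq_left hy.le]
    refine (HasDerivAt.congr_of_eventuallyEq ?_ hev)
    have h := hasDerivAt_pow (k + 2) x
    rw [show k + 2 - 1 = k + 1 by omega] at h
    push_cast at h
    rw [min_eq_left hx.le]
    exact h
  · rw [min_self, zero_pow (Nat.succ_ne_zero _), mul_zero]
    rw [hasDerivAt_iff_isLittleO_nhds_zero]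
    simp only [zero_add, min_self, smul_zero, sub_zero]
    refine Asymptotics.isLittleO_iff.2 fun ε hε => ?_
    filter_upwards [Metric.ball_mem_nhds (0 : ℝ) (lt_min hε one_pos)] with y hy
    rw [Metric.mem_ball, dist_zero_right, Real.norm_eq_abs] at hy
    have hy1 : |y| < 1 := hy.trans_le (min_le_right _ _)
    have hyε : |y| < ε := hy.trans_le (min_le_left _ _)
    have hmin : |min y 0| ≤ |y| := by
      rcases le_total y 0 with h | h
      · rw [min_eq_left h]
      · rw [min_eq_right h, abs_zero]; exact abs_nonneg _
    rw [zero_pow (Nat.succ_ne_zero _), sub_zero, Real.norm_eq_abs, Real.norm_eq_abs, abs_pow]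
    calc |min y 0| ^ (k + 2) ≤ |y| ^ (k + 2) := pow_le_pow_left₀ (abs_nonneg _) hmin _
      _ = |y| ^ (k + 1) * |y| := pow_succ _ _
      _ ≤ ε * |y| := by
          refine mul_le_mul_of_nonneg_right ?_ (abs_nonneg _)
          calc |y| ^ (k + 1) ≤ |y| ^ 1 := pow_le_pow_of_le_one (abs_nonneg _) hy1.le (by omega)
            _ ≤ ε := by rw [pow_one]; exact hyε.le
  · have hev : (fun y : ℝ => min y 0 ^ (k + 2)) =ᶠ[𝓝 x] fun _ => 0 := by
      filter_upwards [lt_mem_nhds hx] with y hy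
      rw [min_eq_right hy.le, zero_pow (Nat.succ_ne_zero _)]
    refine HasDerivAt.congr_of_eventuallyEq ?_ hev
    rw [min_eq_right hx.le, zero_pow (Nat.succ_ne_zero _), mul_zero]
    exact hasDerivAt_const x 0

/-- `Φ(x) = min(x,0)⁴`. [folklore] -/
def negPartPow4 (x : ℝ) : ℝ := min x 0 ^ 4
/-- `Φ'(x) = 4 min(x,0)³`. [folklore] -/
def negPartPow4D (x : ℝ) : ℝ := 4 * min x 0 ^ 3
/-- `Φ''(x) = 12 min(x,0)²`. [folklore] -/
def negPartPow4DD (x : ℝ) : ℝ := 12 * min x 0 ^ 2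

/-- `Φ' ` is the derivative of `Φ`. [folklore] -/
theorem hasDerivAt_negPartPow4 (x : ℝ) : HasDerivAt negPartPow4 (negPartPow4D x) x := by
  have h := hasDerivAt_min_zero_pow 2 x
  norm_num at h
  exact h

/-- `Φ''` is the derivative of `Φ'`. [folklore] -/
theorem hasDerivAt_negPartPow4D (x : ℝ) : HasDerivAt negPartPow4D (negPartPow4DD x) x := by
  have h := (hasDerivAt_min_zero_pow 1 x).const_mul 4
  norm_num at h
  refine h.congr_deriv ?_
  unfold negPartPow4DD
  ring

/-- `Φ ≥ 0`. [folklore] -/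
theorem negPartPow4_nonneg (x : ℝ) : 0 ≤ negPartPow4 x := by
  unfold negPartPow4; positivity

/-- `Φ'' ≥ 0` (convexity). [folklore] -/
theorem negPartPow4DD_nonneg (x : ℝ) : 0 ≤ negPartPow4DD x := by
  unfold negPartPow4DD; positivity

/-- `Φ(x) = 0` for `x ≥ 0`. [folklore] -/
theorem negPartPow4_of_nonneg {x : ℝ} (hx : 0 ≤ x) : negPartPow4 x = 0 := by
  unfold negPartPow4; rw [min_eq_right hx]; norm_num

/-- `Φ(x) > 0` for `x < 0`. [folklore] -/
theorem negPartPow4_pos {x : ℝ} (hx : x < 0) : 0 < negPartPow4 x := by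
  unfold negPartPow4
  rw [min_eq_left hx.le, show x ^ 4 = (-x) ^ 4 by ring]
  exact pow_pos (neg_pos.2 hx) 4

/-- `Φ(x) = 0` iff `x ≥ 0`. [folklore] -/
theorem negPartPow4_eq_zero_iff {x : ℝ} : negPartPow4 x = 0 ↔ 0 ≤ x :=
  ⟨fun h => not_lt.1 fun hx => (negPartPow4_pos hx).ne' h, negPartPow4_of_nonneg⟩

/-- `Φ`, `Φ'`, `Φ''` are continuous. [folklore] -/
theorem continuous_negPartPow4 : Continuous negPartPow4 := by unfold negPartPow4; fun_prop
/-- see `continuous_negPartPow4`. [folklore] -/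
theorem continuous_negPartPow4D : Continuous negPartPow4D := by unfold negPartPow4D; fun_prop
/-- see `continuous_negPartPow4`. [folklore] -/
theorem continuous_negPartPow4DD : Continuous negPartPow4DD := by unfold negPartPow4DD; fun_prop

/-! ### The polynomial heat flow -/

/-- **The polynomial heat flow** `V(z, t) = Σ_{n<N} b_n e^{-μ n(n+1) t} y_n(z)`. [folklore] -/
def jacobiHeatFin (c μ : ℝ) (b : ℕ → ℝ) (N : ℕ) (z t : ℝ) : ℝ :=
  ∑ n ∈ Finset.range N, b n * Real.exp (-(μ * n * (n + 1) * t)) * (hypJacobi c n).eval z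

/-- `∂_z V`. [folklore] -/
def jacobiHeatFinDz (c μ : ℝ) (b : ℕ → ℝ) (N : ℕ) (z t : ℝ) : ℝ :=
  ∑ n ∈ Finset.range N, b n * Real.exp (-(μ * n * (n + 1) * t)) * (derivative (hypJacobi c n)).eval z

/-- `∂²_z V`. [folklore] -/
def jacobiHeatFinDzz (c μ : ℝ) (b : ℕ → ℝ) (N : ℕ) (z t : ℝ) : ℝ :=
  ∑ n ∈ Finset.range N,
    b n * Real.exp (-(μ * n * (n + 1) * t)) * (derivative (derivative (hypJacobi c n))).eval z

/-- `∂ₜ V`. [folklore] -/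
def jacobiHeatFinDt (c μ : ℝ) (b : ℕ → ℝ) (N : ℕ) (z t : ℝ) : ℝ :=
  ∑ n ∈ Finset.range N,
    -(μ * n * (n + 1)) * (b n * Real.exp (-(μ * n * (n + 1) * t)) * (hypJacobi c n).eval z)

section Fin

variable (c μ : ℝ) (b : ℕ → ℝ) (N : ℕ)

/-- `∂_z V` is the `z`-derivative. [folklore] -/
theorem hasDerivAt_jacobiHeatFin_z (z t : ℝ) :
    HasDerivAt (fun x => jacobiHeatFin c μ b N x t) (jacobiHeatFinDz c μ b N z t) z := by
  unfold jacobiHeatFin jacobiHeatFinDz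
  refine HasDerivAt.fun_sum fun n _ => ?_
  exact (hasDerivAt_hypJacobi_eval c n z).const_mul _

/-- `∂²_z V` is the `z`-derivative of `∂_z V`. [folklore] -/
theorem hasDerivAt_jacobiHeatFinDz_z (z t : ℝ) :
    HasDerivAt (fun x => jacobiHeatFinDz c μ b N x t) (jacobiHeatFinDzz c μ b N z t) z := by
  unfold jacobiHeatFinDz jacobiHeatFinDzz
  refine HasDerivAt.fun_sum fun n _ => ?_
  exact (hasDerivAt_derivative_hypJacobi_eval c n z).const_mul _

/-- `∂ₜ V` is the `t`-derivative. [folklore] -/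
theorem hasDerivAt_jacobiHeatFin_t (z t : ℝ) :
    HasDerivAt (fun s => jacobiHeatFin c μ b N z s) (jacobiHeatFinDt c μ b N z t) t := by
  unfold jacobiHeatFin jacobiHeatFinDt
  refine HasDerivAt.fun_sum fun n _ => ?_
  have h1 : HasDerivAt (fun s : ℝ => -(μ * n * (n + 1) * s)) (-(μ * n * (n + 1))) t :=
    (((hasDerivAt_id t).const_mul (μ * n * (n + 1))).neg).congr_deriv (by simp)
  exact ((h1.exp.const_mul (b n)).mul_const ((hypJacobi c n).eval z)).congr_deriv (by ring)

/-- **The heat equation for `V`**: `∂ₜ V = μ [z(1-z) ∂²_z V + (c-2z) ∂_z V]` at every real `z`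
(`1 < c`, Euler's equation termwise). [folklore] -/
theorem jacobiHeatFin_pde (hc : 1 < c) (z t : ℝ) :
    jacobiHeatFinDt c μ b N z t =
      μ * (z * (1 - z) * jacobiHeatFinDzz c μ b N z t + (c - 2 * z) * jacobiHeatFinDz c μ b N z t) := by
  unfold jacobiHeatFinDt jacobiHeatFinDzz jacobiHeatFinDz
  rw [Finset.mul_sum, Finset.mul_sum, ← Finset.sum_add_distrib, Finset.mul_sum]
  refine Finset.sum_congr rfl fun n _ => ?_
  have hode := hypJacobi_ode_eval n (c := c) (fun k _ => by positivity) z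
  linear_combination (-(μ * b n * Real.exp (-(μ * n * (n + 1) * t)))) * hode

/-- `V`, `∂_z V`, `∂ₜ V` are jointly continuous. [folklore] -/
theorem continuous_jacobiHeatFin : Continuous fun p : ℝ × ℝ => jacobiHeatFin c μ b N p.1 p.2 := by
  unfold jacobiHeatFin
  refine continuous_finsetSum _ fun n _ => ?_
  exact (continuous_const.mul (Real.continuous_exp.comp (by fun_prop))).mul
    ((continuous_hypJacobi_eval c n).comp continuous_fst)

/-- see `continuous_jacobiHeatFin`. [folklore] -/
theorem continuous_jacobiHeatFinDz : Continuous fun p : ℝ × ℝ => jacobiHeatFinDz c μ b N p.1 p.2 := by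
  unfold jacobiHeatFinDz
  refine continuous_finsetSum _ fun n _ => ?_
  exact (continuous_const.mul (Real.continuous_exp.comp (by fun_prop))).mul
    ((Polynomial.differentiable _).continuous.comp continuous_fst)

/-- see `continuous_jacobiHeatFin`. [folklore] -/
theorem continuous_jacobiHeatFinDzz :
    Continuous fun p : ℝ × ℝ => jacobiHeatFinDzz c μ b N p.1 p.2 := by
  unfold jacobiHeatFinDzz
  refine continuous_finsetSum _ fun n _ => ?_
  exact (continuous_const.mul (Real.continuous_exp.comp (by fun_prop))).mul
    ((Polynomial.differentiable _).continuous.comp continuous_fst)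

/-- see `continuous_jacobiHeatFin`. [folklore] -/
theorem continuous_jacobiHeatFinDt : Continuous fun p : ℝ × ℝ => jacobiHeatFinDt c μ b N p.1 p.2 := by
  unfold jacobiHeatFinDt
  refine continuous_finsetSum _ fun n _ => continuous_const.mul ?_
  exact (continuous_const.mul (Real.continuous_exp.comp (by fun_prop))).mul
    ((continuous_hypJacobi_eval c n).comp continuous_fst)

/-- A continuous function on `ℝ × ℝ` is bounded on `[0, 1] × [T₀, T₁]`. [folklore] -/
theorem exists_bound_on_box {F : ℝ × ℝ → ℝ} (hF : Continuous F) (T₀ T₁ : ℝ) :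
    ∃ M : ℝ, ∀ z ∈ Icc (0 : ℝ) 1, ∀ t ∈ Icc T₀ T₁, |F (z, t)| ≤ M := by
  obtain ⟨M, hM⟩ := (isCompact_Icc.prod isCompact_Icc).exists_bound_of_continuousOn
    (s := Icc (0 : ℝ) 1 ×ˢ Icc T₀ T₁) hF.continuousOn
  exact ⟨M, fun z hz t ht => by simpa [Real.norm_eq_abs] using hM (z, t) ⟨hz, ht⟩⟩

end Fin

/-- `ρ` is measurable. [folklore] -/
theorem measurable_jacobiWeight (c : ℝ) : Measurable (jacobiWeight c) :=
  (measurable_id.pow_const _).mul ((measurable_const.sub measurable_id).pow_const _)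

/-! ### Positivity preservation -/

section Positivity

variable {c μ : ℝ} (hc : 1 < c) (hc2 : c < 2) (b : ℕ → ℝ) (N : ℕ)
include hc hc2

/-- The energy `E(t) = ∫₀¹ ρ Φ(V(z, t)) dz`. [folklore] -/
def heatEnergy (c μ : ℝ) (b : ℕ → ℝ) (N : ℕ) (t : ℝ) : ℝ :=
  ∫ z in (0 : ℝ)..1, jacobiWeight c z * negPartPow4 (jacobiHeatFin c μ b N z t)

/-- **`E'(t) = ∫₀¹ ρ Φ'(V) ∂ₜ V`** (differentiation under the integral sign; the integrand and its
`t`-derivative are `ρ` times bounded continuous functions). [folklore] -/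
theorem hasDerivAt_heatEnergy (t : ℝ) :
    HasDerivAt (heatEnergy c μ b N)
      (∫ z in (0 : ℝ)..1, jacobiWeight c z *
        (negPartPow4D (jacobiHeatFin c μ b N z t) * jacobiHeatFinDt c μ b N z t)) t := by
  have hcontG : Continuous fun p : ℝ × ℝ =>
      negPartPow4D (jacobiHeatFin c μ b N p.1 p.2) * jacobiHeatFinDt c μ b N p.1 p.2 :=
    (continuous_negPartPow4D.comp (continuous_jacobiHeatFin c μ b N)).mul
      (continuous_jacobiHeatFinDt c μ b N)
  obtain ⟨M, hM⟩ := exists_bound_on_box hcontG (t - 1) (t + 1)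
  have hρ := intervalIntegrable_jacobiWeight hc.le hc2
  have hIoc : Ι (0 : ℝ) 1 = Ioc 0 1 := uIoc_of_le zero_le_one
  have key := intervalIntegral.hasDerivAt_integral_of_dominated_loc_of_deriv_le
    (μ := volume) (a := 0) (b := 1) (x₀ := t) (s := Icc (t - 1) (t + 1))
    (F := fun s z => jacobiWeight c z * negPartPow4 (jacobiHeatFin c μ b N z s))
    (F' := fun s z => jacobiWeight c z *
      (negPartPow4D (jacobiHeatFin c μ b N z s) * jacobiHeatFinDt c μ b N z s))
    (bound := fun z => ‖jacobiWeight c z‖ * M)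
    (Icc_mem_nhds (by linarith) (by linarith))
    (Eventually.of_forall fun s =>
      ((measurable_jacobiWeight c).mul (continuous_negPartPow4.comp
        ((continuous_jacobiHeatFin c μ b N).comp
          (Continuous.prodMk_left s))).measurable).aestronglyMeasurable)
    (intervalIntegrable_jacobiWeight_mul hc.le hc2 (continuous_negPartPow4.comp
      ((continuous_jacobiHeatFin c μ b N).comp (Continuous.prodMk_left t))))
    ((measurable_jacobiWeight c).mul
      (hcontG.comp (Continuous.prodMk_left t)).measurable).aestronglyMeasurable
    (ae_of_all _ fun z hz s hs => by
      rw [hIoc] at hz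
      rw [norm_mul]
      exact mul_le_mul_of_nonneg_left (by simpa [Real.norm_eq_abs] using hM z ⟨hz.1.le, hz.2⟩ s hs)
        (norm_nonneg _))
    (hρ.norm.mul_const M)
    (ae_of_all _ fun z _ s _ => by
      have h := (hasDerivAt_negPartPow4 _).comp s (hasDerivAt_jacobiHeatFin_t c μ b N z s)
      exact h.const_mul _)
  exact key.2

/-- **The energy dissipation identity**: `E'(t) = -μ ∫₀¹ P Φ''(V) (∂_z V)²` — from
`ρ ∂ₜ V = μ (P ∂_z V)'` and the fundamental theorem of calculus for `Φ'(V) P ∂_z V`, which vanishes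
at both ends. [folklore] -/
theorem deriv_heatEnergy_eq (t : ℝ) :
    ∫ z in (0 : ℝ)..1, jacobiWeight c z *
        (negPartPow4D (jacobiHeatFin c μ b N z t) * jacobiHeatFinDt c μ b N z t)
      = -μ * ∫ z in (0 : ℝ)..1, jacobiFlux c z * (negPartPow4DD (jacobiHeatFin c μ b N z t)
          * (jacobiHeatFinDz c μ b N z t) ^ 2) := by
  set V : ℝ → ℝ := fun z => jacobiHeatFin c μ b N z t with hV
  set Vz : ℝ → ℝ := fun z => jacobiHeatFinDz c μ b N z t with hVz
  set Vzz : ℝ → ℝ := fun z => jacobiHeatFinDzz c μ b N z t with hVzz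
  set Vt : ℝ → ℝ := fun z => jacobiHeatFinDt c μ b N z t with hVt
  have hVc : Continuous V := (continuous_jacobiHeatFin c μ b N).comp (Continuous.prodMk_left t)
  have hVzc : Continuous Vz := (continuous_jacobiHeatFinDz c μ b N).comp (Continuous.prodMk_left t)
  have hVzzc : Continuous Vzz :=
    (continuous_jacobiHeatFinDzz c μ b N).comp (Continuous.prodMk_left t)
  have hPc := continuous_jacobiFlux (by linarith : 0 < c) hc2
  -- `H = Φ'(V) P Vz`, continuous on `[0,1]`, zero at the ends
  set H : ℝ → ℝ := fun z => negPartPow4D (V z) * (jacobiFlux c z * Vz z) with hH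
  -- the two pieces of `H'`
  set f₁ : ℝ → ℝ := fun z => negPartPow4DD (V z) * Vz z * (jacobiFlux c z * Vz z) with hf₁
  set f₂ : ℝ → ℝ := fun z => negPartPow4D (V z) *
    (jacobiWeight c z * ((z * (1 - z) * Vzz z + (c - 2 * z) * Vz z))) with hf₂
  have hderiv : ∀ z ∈ Ioo (0 : ℝ) 1, HasDerivAt H (f₁ z + f₂ z) z := by
    intro z hz
    have h1 : HasDerivAt (fun z => negPartPow4D (V z)) (negPartPow4DD (V z) * Vz z) z :=
      (hasDerivAt_negPartPow4D _).comp z (hasDerivAt_jacobiHeatFin_z c μ b N z t)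
    have h2 : HasDerivAt (fun z => jacobiFlux c z * Vz z)
        (jacobiWeight c z * (c - 2 * z) * Vz z + jacobiFlux c z * Vzz z) z :=
      (hasDerivAt_jacobiFlux c hz).mul (hasDerivAt_jacobiHeatFinDz_z c μ b N z t)
    refine (h1.mul h2).congr_deriv ?_
    simp only [hf₁, hf₂, jacobiFlux_eq hc hc2 (Ioo_subset_Icc_self hz)]
    ring
  have hi₁ : IntervalIntegrable f₁ volume 0 1 :=
    ((((continuous_negPartPow4DD.comp hVc).mul hVzc).mul (hPc.mul hVzc)).intervalIntegrable 0 1)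
  have hi₂ : IntervalIntegrable f₂ volume 0 1 := by
    have := intervalIntegrable_jacobiWeight_mul hc.le hc2
      (g := fun z => negPartPow4D (V z) * (z * (1 - z) * Vzz z + (c - 2 * z) * Vz z))
      (((continuous_negPartPow4D.comp hVc)).mul (by fun_prop))
    refine this.congr ?_
    intro z _
    simp only [hf₂]; ring
  have hcont : ContinuousOn H (Icc 0 1) :=
    ((continuous_negPartPow4D.comp hVc).mul (hPc.mul hVzc)).continuousOn
  have hftc := intervalIntegral.integral_eq_sub_of_hasDerivAt_of_le zero_le_one hcont hderiv
    (hi₁.add hi₂)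
  simp only [hH, jacobiFlux_zero (by linarith : c ≠ 0), jacobiFlux_one (by linarith : c ≠ 2),
    zero_mul, mul_zero, sub_self] at hftc
  rw [intervalIntegral.integral_add hi₁ hi₂] at hftc
  -- `ρ Φ'(V) Vt = μ f₂`
  have hlhs : ∫ z in (0 : ℝ)..1, jacobiWeight c z * (negPartPow4D (V z) * Vt z)
      = μ * ∫ z in (0 : ℝ)..1, f₂ z := by
    rw [← intervalIntegral.integral_const_mul]
    refine intervalIntegral.integral_congr fun z _ => ?_
    simp only [hf₂, hVt, hVzz, hVz, jacobiHeatFin_pde c μ b N hc z t]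
    ring
  have hrhs : ∫ z in (0 : ℝ)..1, jacobiFlux c z * (negPartPow4DD (V z) * (Vz z) ^ 2)
      = ∫ z in (0 : ℝ)..1, f₁ z :=
    intervalIntegral.integral_congr fun z _ => by simp only [hf₁]; ring
  rw [hlhs, hrhs]
  linear_combination μ * hftc

/-- **`E` is non-increasing** (`E' = -μ ∫ P Φ''(V) (∂_z V)² ≤ 0`). [folklore] -/
theorem antitone_heatEnergy (hμ : 0 ≤ μ) : Antitone (heatEnergy c μ b N) := by
  refine antitone_of_deriv_nonpos (fun t => (hasDerivAt_heatEnergy hc hc2 b N t).differentiableAt)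
    fun t => ?_
  rw [(hasDerivAt_heatEnergy hc hc2 b N t).deriv, deriv_heatEnergy_eq hc hc2 b N t]
  have : 0 ≤ ∫ z in (0 : ℝ)..1, jacobiFlux c z * (negPartPow4DD (jacobiHeatFin c μ b N z t)
      * (jacobiHeatFinDz c μ b N z t) ^ 2) :=
    intervalIntegral.integral_nonneg zero_le_one fun z hz =>
      mul_nonneg (jacobiFlux_nonneg c hz) (mul_nonneg (negPartPow4DD_nonneg _) (sq_nonneg _))
  nlinarith

omit hc hc2 in
/-- `E ≥ 0`. [folklore] -/
theorem heatEnergy_nonneg (t : ℝ) : 0 ≤ heatEnergy c μ b N t :=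
  intervalIntegral.integral_nonneg zero_le_one fun _ hz =>
    mul_nonneg (jacobiWeight_nonneg c hz) (negPartPow4_nonneg _)

omit hc hc2 in
/-- `E(0) = 0` if `V(·, 0) ≥ 0` on `[0, 1]`. [folklore] -/
theorem heatEnergy_zero (h0 : ∀ z ∈ Icc (0 : ℝ) 1, 0 ≤ jacobiHeatFin c μ b N z 0) :
    heatEnergy c μ b N 0 = 0 := by
  unfold heatEnergy
  rw [intervalIntegral.integral_congr (g := fun _ => (0 : ℝ)) fun z hz => ?_]
  · simp
  · rw [uIcc_of_le zero_le_one] at hz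
    simp only [negPartPow4_of_nonneg (h0 z hz), mul_zero]

/-- **Positivity preservation**: if `V(·, 0) ≥ 0` on `[0, 1]` then `V(z, t) ≥ 0` for all `t ≥ 0`,
`z ∈ [0, 1]`. [folklore] -/
theorem jacobiHeatFin_nonneg (hμ : 0 ≤ μ) (h0 : ∀ z ∈ Icc (0 : ℝ) 1, 0 ≤ jacobiHeatFin c μ b N z 0)
    {t : ℝ} (ht : 0 ≤ t) {z : ℝ} (hz : z ∈ Icc (0 : ℝ) 1) : 0 ≤ jacobiHeatFin c μ b N z t := by
  -- `E(t) = 0`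
  have hE : heatEnergy c μ b N t = 0 :=
    le_antisymm ((antitone_heatEnergy hc hc2 b N hμ ht).trans_eq (heatEnergy_zero b N h0))
      (heatEnergy_nonneg b N t)
  -- first on the open interval, by contradiction
  have hopen : ∀ y ∈ Ioo (0 : ℝ) 1, 0 ≤ jacobiHeatFin c μ b N y t := by
    intro y hy
    by_contra hneg
    push Not at hneg
    have hVc : Continuous fun z => jacobiHeatFin c μ b N z t :=
      (continuous_jacobiHeatFin c μ b N).comp (Continuous.prodMk_left t)
    -- `V < 0` near `y`
    have hev : ∀ᶠ z in 𝓝 y, jacobiHeatFin c μ b N z t < 0 :=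
      hVc.continuousAt.eventually (gt_mem_nhds hneg)
    obtain ⟨ε, hε, hball⟩ := Metric.eventually_nhds_iff.1 hev
    set δ := min ε (min (y / 2) ((1 - y) / 2)) with hδ
    have hδ0 : 0 < δ := lt_min hε (lt_min (by linarith [hy.1]) (by linarith [hy.2]))
    have hδε : δ ≤ ε := min_le_left _ _
    have hδy : δ ≤ y / 2 := (min_le_right _ _).trans (min_le_left _ _)
    have hδy' : δ ≤ (1 - y) / 2 := (min_le_right _ _).trans (min_le_right _ _)
    set f : ℝ → ℝ := fun z => jacobiWeight c z * negPartPow4 (jacobiHeatFin c μ b N z t) with hf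
    have hfi : IntervalIntegrable f volume 0 1 :=
      intervalIntegrable_jacobiWeight_mul hc.le hc2 (continuous_negPartPow4.comp hVc)
    have hfnn : ∀ z ∈ Icc (0 : ℝ) 1, 0 ≤ f z := fun z hz =>
      mul_nonneg (jacobiWeight_nonneg c hz) (negPartPow4_nonneg _)
    -- `∫_{y-δ}^{y+δ} f > 0`
    have hsub : Icc (y - δ) (y + δ) ⊆ Icc 0 1 := Icc_subset_Icc (by linarith) (by linarith)
    have hpos : 0 < ∫ z in (y - δ)..(y + δ), f z := by
      refine intervalIntegral.intervalIntegral_pos_of_pos_on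
        (hfi.mono_set (by rw [uIcc_of_le (by linarith), uIcc_of_le zero_le_one]; exact hsub))
        (fun z hz => ?_) (by linarith)
      have hz01 : z ∈ Ioo (0 : ℝ) 1 := ⟨by linarith [hz.1], by linarith [hz.2]⟩
      have hVneg : jacobiHeatFin c μ b N z t < 0 := hball (by
        rw [Real.dist_eq, abs_lt]; constructor <;> linarith [hz.1, hz.2])
      exact mul_pos (jacobiWeight_pos c hz01) (negPartPow4_pos hVneg)
    have hle : ∫ z in (y - δ)..(y + δ), f z ≤ ∫ z in (0 : ℝ)..1, f z :=
      intervalIntegral.integral_mono_interval (by linarith) (by linarith) (by linarith)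
        ((ae_restrict_mem measurableSet_Ioc).mono fun z hz => hfnn z ⟨hz.1.le, hz.2⟩) hfi
    have : (0 : ℝ) < heatEnergy c μ b N t := hpos.trans_le hle
    linarith
  -- endpoints by continuity
  have hVc : Continuous fun z => jacobiHeatFin c μ b N z t :=
    (continuous_jacobiHeatFin c μ b N).comp (Continuous.prodMk_left t)
  have hclosed : IsClosed {y : ℝ | 0 ≤ jacobiHeatFin c μ b N y t} := isClosed_le continuous_const hVc
  have := hclosed.closure_subset_iff.2 (show Ioo (0 : ℝ) 1 ⊆ _ from hopen)
  rw [closure_Ioo zero_ne_one] at this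
  exact this hz

end Positivity

/-! ### The sub-Markov (flux) identity -/

/-- `(1-z)^{1-c} g` is integrable on `[0,1]` for continuous `g` (`c < 2`). [folklore] -/
theorem intervalIntegrable_one_sub_rpow_mul {c : ℝ} (hc2 : c < 2) {g : ℝ → ℝ} (hg : Continuous g) :
    IntervalIntegrable (fun z : ℝ => (1 - z) ^ (1 - c) * g z) volume 0 1 :=
  (intervalIntegrable_one_sub_rpow hc2).mul_continuousOn hg.continuousOn

/-- The weighted integral `I(t) = ∫₀¹ (1-z)^{1-c} V(z, t) dz`. [folklore] -/
def weightedIntegral (c μ : ℝ) (b : ℕ → ℝ) (N : ℕ) (t : ℝ) : ℝ :=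
  ∫ z in (0 : ℝ)..1, (1 - z) ^ (1 - c) * jacobiHeatFin c μ b N z t

section Flux

variable {c μ : ℝ} (hc : 1 < c) (hc2 : c < 2) (b : ℕ → ℝ) (N : ℕ)
include hc hc2

omit hc in
/-- **`I'(t) = ∫₀¹ (1-z)^{1-c} ∂ₜ V`**. [folklore] -/
theorem hasDerivAt_weightedIntegral (t : ℝ) :
    HasDerivAt (weightedIntegral c μ b N)
      (∫ z in (0 : ℝ)..1, (1 - z) ^ (1 - c) * jacobiHeatFinDt c μ b N z t) t := by
  obtain ⟨M, hM⟩ := exists_bound_on_box (continuous_jacobiHeatFinDt c μ b N) (t - 1) (t + 1)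
  have hIoc : Ι (0 : ℝ) 1 = Ioc 0 1 := uIoc_of_le zero_le_one
  have key := intervalIntegral.hasDerivAt_integral_of_dominated_loc_of_deriv_le
    (μ := volume) (a := 0) (b := 1) (x₀ := t) (s := Icc (t - 1) (t + 1))
    (F := fun s z => (1 - z) ^ (1 - c) * jacobiHeatFin c μ b N z s)
    (F' := fun s z => (1 - z) ^ (1 - c) * jacobiHeatFinDt c μ b N z s)
    (bound := fun z => ‖(1 - z) ^ (1 - c)‖ * M)
    (Icc_mem_nhds (by linarith) (by linarith))
    (Eventually.of_forall fun s => (((measurable_const.sub measurable_id).pow_const _).mul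
      ((continuous_jacobiHeatFin c μ b N).comp
        (Continuous.prodMk_left s)).measurable).aestronglyMeasurable)
    (intervalIntegrable_one_sub_rpow_mul hc2
      ((continuous_jacobiHeatFin c μ b N).comp (Continuous.prodMk_left t)))
    (((measurable_const.sub measurable_id).pow_const _).mul
      ((continuous_jacobiHeatFinDt c μ b N).comp
        (Continuous.prodMk_left t)).measurable).aestronglyMeasurable
    (ae_of_all _ fun z hz s hs => by
      rw [hIoc] at hz
      rw [norm_mul]
      exact mul_le_mul_of_nonneg_left (by simpa [Real.norm_eq_abs] using hM z ⟨hz.1.le, hz.2⟩ s hs)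
        (norm_nonneg _))
    ((intervalIntegrable_one_sub_rpow hc2).norm.mul_const M)
    (ae_of_all _ fun z _ s _ => (hasDerivAt_jacobiHeatFin_t c μ b N z s).const_mul _)
  exact key.2

/-- **The flux computation**: `∫₀¹ (1-z)^{1-c} ∂ₜ V = μ(c-1) [(2-c) ∫₀¹ (1-z)^{1-c} V - V(0)]`
(two integrations by parts; `(1-z)^{1-c} = ρ z^{1-c}`, the boundary term at the Dirichlet end
`z = 0` survives). [folklore] -/
theorem integral_weight_mul_jacobiHeatFinDt (t : ℝ) :
    ∫ z in (0 : ℝ)..1, (1 - z) ^ (1 - c) * jacobiHeatFinDt c μ b N z t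
      = μ * (c - 1) * ((2 - c) * weightedIntegral c μ b N t - jacobiHeatFin c μ b N 0 t) := by
  set V : ℝ → ℝ := fun z => jacobiHeatFin c μ b N z t with hV
  set Vz : ℝ → ℝ := fun z => jacobiHeatFinDz c μ b N z t with hVz
  set Vzz : ℝ → ℝ := fun z => jacobiHeatFinDzz c μ b N z t with hVzz
  have hVc : Continuous V := (continuous_jacobiHeatFin c μ b N).comp (Continuous.prodMk_left t)
  have hVzc : Continuous Vz := (continuous_jacobiHeatFinDz c μ b N).comp (Continuous.prodMk_left t)
  have hVzzc : Continuous Vzz :=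
    (continuous_jacobiHeatFinDzz c μ b N).comp (Continuous.prodMk_left t)
  have hc1 : 0 < c - 1 := by linarith
  have h2c : 0 < 2 - c := by linarith
  -- continuity of the weights on `[0,1]`
  have hw2 : Continuous fun z : ℝ => (1 - z) ^ (2 - c) :=
    (continuous_const.sub continuous_id).rpow_const fun _ => Or.inr h2c.le
  -- first FTC: `H₁ = z (1-z)^{2-c} Vz`
  set g₁ : ℝ → ℝ := fun z => (1 - z) ^ (1 - c) * (z * (1 - z) * Vzz z + (1 - (3 - c) * z) * Vz z)
    with hg₁
  have hH₁ : ∫ z in (0 : ℝ)..1, g₁ z = 0 := by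
    have hcont : ContinuousOn (fun z : ℝ => z * (1 - z) ^ (2 - c) * Vz z) (Icc 0 1) :=
      ((continuous_id.mul hw2).mul hVzc).continuousOn
    have hderiv : ∀ z ∈ Ioo (0 : ℝ) 1,
        HasDerivAt (fun z : ℝ => z * (1 - z) ^ (2 - c) * Vz z) (g₁ z) z := by
      intro z hz
      have h1z : (1 : ℝ) - z ≠ 0 := by linarith [hz.2]
      have hA : HasDerivAt (fun y : ℝ => (1 - y) ^ (2 - c)) ((0 - 1) * (2 - c) * (1 - z) ^ (2 - c - 1))
          z := ((hasDerivAt_const z (1 : ℝ)).sub (hasDerivAt_id z)).rpow_const (Or.inl h1z)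
      have h := ((hasDerivAt_id z).mul hA).mul (hasDerivAt_jacobiHeatFinDz_z c μ b N z t)
      refine h.congr_deriv ?_
      have e1 : (1 - z) ^ (2 - c - 1) = (1 - z) ^ (1 - c) := by rw [show (2:ℝ) - c - 1 = 1 - c by ring]
      have e2 : (1 - z) ^ (2 - c) = (1 - z) ^ (1 - c) * (1 - z) := by
        rw [← Real.rpow_add_one h1z, show (1 : ℝ) - c + 1 = 2 - c by ring]
      simp only [hg₁, Pi.mul_apply, id_eq, e1, e2]
      ring
    have hint : IntervalIntegrable g₁ volume 0 1 :=
      intervalIntegrable_one_sub_rpow_mul hc2 (by fun_prop)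
    have := intervalIntegral.integral_eq_sub_of_hasDerivAt_of_le zero_le_one hcont hderiv hint
    rw [this]
    simp only [sub_self, Real.zero_rpow h2c.ne', mul_zero, zero_mul, sub_zero]
  -- second FTC: `H₂ = (1-z)^{2-c} V`
  set g₂ : ℝ → ℝ := fun z => (1 - z) ^ (1 - c) * ((1 - z) * Vz z - (2 - c) * V z) with hg₂
  have hH₂ : ∫ z in (0 : ℝ)..1, g₂ z = -V 0 := by
    have hcont : ContinuousOn (fun z : ℝ => (1 - z) ^ (2 - c) * V z) (Icc 0 1) :=
      (hw2.mul hVc).continuousOn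
    have hderiv : ∀ z ∈ Ioo (0 : ℝ) 1,
        HasDerivAt (fun z : ℝ => (1 - z) ^ (2 - c) * V z) (g₂ z) z := by
      intro z hz
      have h1z : (1 : ℝ) - z ≠ 0 := by linarith [hz.2]
      have hA : HasDerivAt (fun y : ℝ => (1 - y) ^ (2 - c)) ((0 - 1) * (2 - c) * (1 - z) ^ (2 - c - 1))
          z := ((hasDerivAt_const z (1 : ℝ)).sub (hasDerivAt_id z)).rpow_const (Or.inl h1z)
      have h := hA.mul (hasDerivAt_jacobiHeatFin_z c μ b N z t)
      refine h.congr_deriv ?_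
      have e1 : (1 - z) ^ (2 - c - 1) = (1 - z) ^ (1 - c) := by rw [show (2:ℝ) - c - 1 = 1 - c by ring]
      have e2 : (1 - z) ^ (2 - c) = (1 - z) ^ (1 - c) * (1 - z) := by
        rw [← Real.rpow_add_one h1z, show (1 : ℝ) - c + 1 = 2 - c by ring]
      simp only [hg₂, e1, e2]
      ring
    have hint : IntervalIntegrable g₂ volume 0 1 :=
      intervalIntegrable_one_sub_rpow_mul hc2 (by fun_prop)
    have := intervalIntegral.integral_eq_sub_of_hasDerivAt_of_le zero_le_one hcont hderiv hint
    rw [this]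
    simp only [sub_self, Real.zero_rpow h2c.ne', zero_mul, sub_zero, Real.one_rpow, one_mul,
      zero_sub]
  -- combine: `(1-z)^{1-c} Vt = μ [g₁ + (c-1)(g₂ + (2-c)(1-z)^{1-c} V)]`
  have hi₁ : IntervalIntegrable g₁ volume 0 1 := intervalIntegrable_one_sub_rpow_mul hc2 (by fun_prop)
  have hi₂ : IntervalIntegrable g₂ volume 0 1 := intervalIntegrable_one_sub_rpow_mul hc2 (by fun_prop)
  have hi₃ : IntervalIntegrable (fun z : ℝ => (1 - z) ^ (1 - c) * V z) volume 0 1 :=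
    intervalIntegrable_one_sub_rpow_mul hc2 hVc
  have hpt : ∀ z, (1 - z) ^ (1 - c) * jacobiHeatFinDt c μ b N z t
      = μ * g₁ z + μ * (c - 1) * g₂ z + μ * (c - 1) * (2 - c) * ((1 - z) ^ (1 - c) * V z) := by
    intro z
    simp only [hg₁, hg₂, hV, hVz, hVzz, jacobiHeatFin_pde c μ b N hc z t]
    ring
  simp_rw [hpt]
  rw [intervalIntegral.integral_add ((hi₁.const_mul μ).add (hi₂.const_mul _)) (hi₃.const_mul _),
    intervalIntegral.integral_add (hi₁.const_mul μ) (hi₂.const_mul _),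
    intervalIntegral.integral_const_mul, intervalIntegral.integral_const_mul,
    intervalIntegral.integral_const_mul, hH₁, hH₂]
  unfold weightedIntegral
  ring

/-- **The sub-Markov identity**: with `λ₀ = μ(c-1)(2-c)`,
`d/dt [e^{-λ₀ t} I(t)] = -μ (c-1) e^{-λ₀ t} V(0, t)`. [folklore] -/
theorem hasDerivAt_exp_mul_weightedIntegral (t : ℝ) :
    HasDerivAt (fun s => Real.exp (-(μ * (c - 1) * (2 - c) * s)) * weightedIntegral c μ b N s)
      (-(μ * (c - 1)) * Real.exp (-(μ * (c - 1) * (2 - c) * t)) * jacobiHeatFin c μ b N 0 t) t := by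
  have h1 : HasDerivAt (fun s : ℝ => -(μ * (c - 1) * (2 - c) * s)) (-(μ * (c - 1) * (2 - c))) t :=
    (((hasDerivAt_id t).const_mul (μ * (c - 1) * (2 - c))).neg).congr_deriv (by simp)
  have h2 := hasDerivAt_weightedIntegral (μ := μ) hc2 b N t
  rw [integral_weight_mul_jacobiHeatFinDt hc hc2 b N t] at h2
  exact (h1.exp.mul h2).congr_deriv (by ring)

/-- **The sub-Markov inequality**: if `V(·, 0) ≥ 0` on `[0,1]` (so `V ≥ 0` for `t ≥ 0` by
`jacobiHeatFin_nonneg`) then `t ↦ e^{-λ₀ t} ∫₀¹ (1-z)^{1-c} V(z,t) dz` is non-increasing on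
`[0, ∞)`; in particular `e^{-λ₀ t} I(t) ≤ I(0)` (`μ > 0`). [folklore] -/
theorem exp_mul_weightedIntegral_le (hμ : 0 < μ)
    (h0 : ∀ z ∈ Icc (0 : ℝ) 1, 0 ≤ jacobiHeatFin c μ b N z 0) {t : ℝ} (ht : 0 ≤ t) :
    Real.exp (-(μ * (c - 1) * (2 - c) * t)) * weightedIntegral c μ b N t
      ≤ weightedIntegral c μ b N 0 := by
  set F : ℝ → ℝ := fun s => Real.exp (-(μ * (c - 1) * (2 - c) * s)) * weightedIntegral c μ b N s
    with hF
  have hanti : AntitoneOn F (Ici 0) := by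
    refine antitoneOn_of_deriv_nonpos (convex_Ici 0)
      (fun s _ => (hasDerivAt_exp_mul_weightedIntegral hc hc2 b N s).continuousAt.continuousWithinAt)
      (fun s _ => (hasDerivAt_exp_mul_weightedIntegral hc hc2 b N s).differentiableAt.differentiableWithinAt)
      fun s hs => ?_
    rw [interior_Ici] at hs
    rw [(hasDerivAt_exp_mul_weightedIntegral hc hc2 b N s).deriv]
    have hV0 : 0 ≤ jacobiHeatFin c μ b N 0 s :=
      jacobiHeatFin_nonneg hc hc2 b N hμ.le h0 (le_of_lt hs) ⟨le_rfl, zero_le_one⟩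
    have : 0 ≤ μ * (c - 1) * Real.exp (-(μ * (c - 1) * (2 - c) * s)) * jacobiHeatFin c μ b N 0 s := by
      have : 0 < c - 1 := by linarith
      positivity
    linarith
  have := hanti (self_mem_Ici) ht ht
  simpa [hF] using this

end Flux

end Literature.Analysis.SpecialFunctions
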